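/-
Copyright (c) 2026. All rights reserved.
Released under Apache 2.0 license as described in the file LICENSE.
Authors: HodgeCM publication cell (pub/hodgecm-mathlib), Track B, seat K2E3-p11 (g4).
-/
import Summits.HodgeConjecture.HodgeConjecture.Theorems.K2E3GL3BorelUnipotentHaar          -- ★ (B1) p857423: `exists_coordHomeomorph`, `exists_haar_eq_smul_map_coord`
import Summits.HodgeConjecture.HodgeConjecture.Theorems.K2E3LieSubspaceFourier            -- ★ p857303: `integral_matrixFourier_nilradical_eq_parabolic`
import Summits.HodgeConjecture.HodgeConjecture.Theorems.K2E3GLnLieAdIntegralInvariant      -- ★ `integral_comp_conj_of_mem_glInt`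
import Summits.HodgeConjecture.HodgeConjecture.Theorems.K2E3GLnNilpotentFourierPointSupport -- ★ `isLocSmooth_matrixFourier`
import HarnessLib

/-!
# K2_E3 road (h413), Richardson road, brick (F-link-J) — the Fourier transform of the REGULAR Richardson measure of `𝔤𝔩₃(F)` is the `K`-average of the Borel slice

Cell `pub/hodgecm-mathlib` (D-0151), Track B, seat K2E3-p11 (g4) (Richardson road owner; squad bus 2026-09-04T04:57Z).
`--supports stmt-HodgeConjecture-24833 --as helper`; THEOREMS ONLY (no definition ∕ instance ∕ notation ∕ named fact ∕ `sorry`); never imports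
`Cruxes/…/Lines`.  COUNT-NEUTRAL ((LBGL-ge3) stays OPEN).

THE MATHEMATICS.  `G = GL₃(F)`, `K = GL₃(𝒪)`, `N₃ = U_id` upper unitriangular, `𝔫₃` strictly upper triangular, `𝔟₃` upper triangular, `𝓕f(Y) = ∫ ψ(tr(Y X)) f(X) dμ𝔤`
the §L matrix Fourier transform.  The regular Richardson measure in the (R1d) ∕ (B3) currency is `Λ_J(φ) = ∫_{K × N₃} φ(k (u − 1) k⁻¹) d(κ ⊗ μ_N)`.  THIS FILE:
**`exists_integral_prod_matrixFourier_borelRichardson_eq`** — ONE constant `C > 0` with, for every `f ∈ C_c^∞(𝔤𝔩₃(F))`,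
`∫_{K × N₃} 𝓕f(k (u − 1) k⁻¹) d(κ ⊗ μ_N) = C · ∫_K ∫_{F⁶} f(k [[r₀,r₁,r₂],[0,r₃,r₄],[0,0,r₅]] k⁻¹) dr dk` — i.e. `Λ_J ∘ 𝓕 = C · (K-average of the Borel slice 𝔟₃)`,
the input of the Borel slice density (F-J) (K2E3-p17 (g6), shape of ★ `K2E3GL2BorelSliceDensity.exists_borelSliceDensity`).  Steps: §1 `matrixFourier_conj_apply`
(`𝓕f(k Y k⁻¹) = 𝓕(f ∘ Ad k)(Y)` for `k ∈ K`, ★ `integral_comp_conj_of_mem_glInt`); §2 linear charts `(F × F) × F ≃L 𝔫₃`, `F⁶ ≃L 𝔟₃` (existence, hypothesis-style) and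
`u − 1 = n(e⁻¹ u)` for the ★ (B1) coordinates `e` of `N₃`; §3 the Haar measure of `N₃` is `C₁ · e_*(dx³)` (★ (B1)), so `∫_{N₃} φ(u − 1) dμ_N = C₁ ∫_{F³} φ(n(p)) dp`, Fubini
on `K × F³`, ★ `integral_matrixFourier_nilradical_eq_parabolic` for the Borel labelling `c = id` (`∫_{𝔫₃} 𝓕g = c₀ ∫_{𝔟₃} g`) with the chart measures, and reassembly.
[HarishChandra1999AdmissibleDistributions, §7, Thm. 4.4 (`μ̂_𝒪` for a Richardson orbit)] [Howe1974, Prop. 3] [WeilBNT1967, Ch. VII §2].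

References: [HarishChandra1999AdmissibleDistributions] Harish-Chandra (DeBacker–Sally), AMS ULECT 16 (1999) · [Howe1974] R. Howe, Math. Ann. 208 (1974) ·
[WeilBNT1967] A. Weil, *Basic Number Theory* (1967).
-/

set_option autoImplicit false
set_option linter.dupNamespace false   -- `Summit.HodgeConjecture.HodgeConjecture.…` (D-0017 nested layout; lakefile exemption for Summits)

noncomputable section

open MeasureTheory MeasureTheory.Measure Filter Topology TopologicalSpace
open scoped MatrixGroups NNReal ENNReal
open Literature.NumberTheory.Rogawski1990 Literature.NumberTheory.Automorphic
open Literature.NumberTheory.GaloisRepresentations Literature.NumberTheory.GaloisRepresentations.IsNonarchimedeanLocalField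
open Summit.HodgeConjecture.HodgeConjecture.Cruxes.H413.K2E3GL3BorelUnipotentHaar
open Summit.HodgeConjecture.HodgeConjecture.Cruxes.H413.K2E3LieSubspaceFourier (integral_matrixFourier_nilradical_eq_parabolic)
open Summit.HodgeConjecture.HodgeConjecture.Cruxes.H413.K2E3GLnLieAdIntegralInvariant (integral_comp_conj_of_mem_glInt)
open Summit.HodgeConjecture.HodgeConjecture.Cruxes.H413.K2E3GLnNilpotentFourierPointSupport (isLocSmooth_matrixFourier)

namespace Summit.HodgeConjecture.HodgeConjecture.Cruxes.H413.K2E3GL3RegularRichardsonFourier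

variable {F : Type*} [Field F] [ValuativeRel F] [TopologicalSpace F] [IsNonarchimedeanLocalField F]

/-! ## §1  `𝓕f(k Y k⁻¹) = 𝓕(f ∘ Ad k)(Y)` for `k ∈ GL_N(𝒪)` -/

/-- **The matrix Fourier transform intertwines `Ad(k)`, `k ∈ GL_N(𝒪)`**: `𝓕f(k Y k⁻¹) = 𝓕(X ↦ f(k X k⁻¹))(Y)` (substitute `X ↦ k X k⁻¹` in `μ𝔤`, ★
`integral_comp_conj_of_mem_glInt`, and `tr(k Y k⁻¹ · k X k⁻¹) = tr(Y X)`). [cite: HarishChandra1999AdmissibleDistributions, §4 p. 11] -/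
theorem matrixFourier_conj_apply {N : ℕ} (ψ : AddChar F Circle) [MeasurableSpace (Matrix (Fin N) (Fin N) F)] [BorelSpace (Matrix (Fin N) (Fin N) F)]
    (μ𝔤 : Measure (Matrix (Fin N) (Fin N) F)) [μ𝔤.IsAddHaarMeasure] {k : GL (Fin N) F} (hk : k ∈ glInt N F)
    (f : Matrix (Fin N) (Fin N) F → ℂ) (Y : Matrix (Fin N) (Fin N) F) :
    ∫ X, ((ψ (Matrix.trace (((k : Matrix (Fin N) (Fin N) F) * Y * ((k⁻¹ : GL (Fin N) F) : Matrix (Fin N) (Fin N) F)) * X)) : Circle) : ℂ) * f X ∂μ𝔤 =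
      ∫ X, ((ψ (Matrix.trace (Y * X)) : Circle) : ℂ) *
        f ((k : Matrix (Fin N) (Fin N) F) * X * ((k⁻¹ : GL (Fin N) F) : Matrix (Fin N) (Fin N) F)) ∂μ𝔤 := by
  rw [← integral_comp_conj_of_mem_glInt μ𝔤 hk (fun X => ((ψ (Matrix.trace (((k : Matrix (Fin N) (Fin N) F) * Y *
    ((k⁻¹ : GL (Fin N) F) : Matrix (Fin N) (Fin N) F)) * X)) : Circle) : ℂ) * f X)]
  refine integral_congr_ae (Eventually.of_forall fun X => ?_)
  have hkk : ((k⁻¹ : GL (Fin N) F) : Matrix (Fin N) (Fin N) F) * (k : Matrix (Fin N) (Fin N) F) = 1 := by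
    rw [← Units.val_mul, inv_mul_cancel, Units.val_one]
  have htr : Matrix.trace ((k : Matrix (Fin N) (Fin N) F) * Y * ((k⁻¹ : GL (Fin N) F) : Matrix (Fin N) (Fin N) F) *
      ((k : Matrix (Fin N) (Fin N) F) * X * ((k⁻¹ : GL (Fin N) F) : Matrix (Fin N) (Fin N) F))) = Matrix.trace (Y * X) := by
    have h1 : (k : Matrix (Fin N) (Fin N) F) * Y * ((k⁻¹ : GL (Fin N) F) : Matrix (Fin N) (Fin N) F) *
        ((k : Matrix (Fin N) (Fin N) F) * X * ((k⁻¹ : GL (Fin N) F) : Matrix (Fin N) (Fin N) F)) =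
        (k : Matrix (Fin N) (Fin N) F) * ((Y * X) * ((k⁻¹ : GL (Fin N) F) : Matrix (Fin N) (Fin N) F)) := by
      simp only [Matrix.mul_assoc]
      rw [← Matrix.mul_assoc ((k⁻¹ : GL (Fin N) F) : Matrix (Fin N) (Fin N) F) (k : Matrix (Fin N) (Fin N) F), hkk, Matrix.one_mul]
    rw [h1, Matrix.trace_mul_comm, Matrix.mul_assoc, Matrix.trace_mul_comm, ← Matrix.mul_assoc, hkk, Matrix.one_mul]
  simp only [htr]

/-! ## §2  Linear charts of `𝔫₃` (strictly upper) and `𝔟₃` (upper triangular) in `𝔤𝔩₃(F)` -/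

section Charts

omit [ValuativeRel F] [IsNonarchimedeanLocalField F]

/-- **The chart of `𝔫₃`**: a subspace `𝔫 = {X | X i j = 0 for j ≤ i}` (the nilradical of the Borel labelling `id`, in the currency of ★
`integral_matrixFourier_nilradical_eq_parabolic`) with a continuous linear chart `n : (F × F) × F ≃L 𝔫`, `n(x, y, z) = [[0,x,z],[0,0,y],[0,0,0]]`. [folklore] -/
theorem exists_strictUpperChart :
    ∃ (𝔫 : Submodule F (Matrix (Fin 3) (Fin 3) F)) (n : ((F × F) × F) ≃L[F] ↥𝔫),
      (∀ X, X ∈ 𝔫 ↔ ∀ i j : Fin 3, (id j) ≤ (id i) → X i j = 0) ∧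
      ∀ p : (F × F) × F, ((n p : ↥𝔫) : Matrix (Fin 3) (Fin 3) F) = !![0, p.1.1, p.2; 0, 0, p.1.2; 0, 0, 0] := by
  let 𝔫 : Submodule F (Matrix (Fin 3) (Fin 3) F) :=
    { carrier := {X | ∀ i j : Fin 3, j ≤ i → X i j = 0}
      add_mem' := fun {X Y} hX hY i j hij => by simp [hX i j hij, hY i j hij]
      zero_mem' := fun i j hij => rfl
      smul_mem' := fun c X hX i j hij => by simp [hX i j hij] }
  have hmem : ∀ p : (F × F) × F, (!![0, p.1.1, p.2; 0, 0, p.1.2; 0, 0, 0] : Matrix (Fin 3) (Fin 3) F) ∈ 𝔫 := fun p i j hij => by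
    fin_cases i <;> fin_cases j <;> first | rfl | exact absurd hij (by decide)
  have hrepr : ∀ X : Matrix (Fin 3) (Fin 3) F, X ∈ 𝔫 → (!![0, X 0 1, X 0 2; 0, 0, X 1 2; 0, 0, 0] : Matrix (Fin 3) (Fin 3) F) = X := fun X hX => by
    ext i j
    fin_cases i <;> fin_cases j <;> first | rfl | exact (hX _ _ (by decide)).symm
  refine ⟨𝔫,
    { toFun := fun p => ⟨_, hmem p⟩
      map_add' := fun p q => Subtype.ext (by ext i j; fin_cases i <;> fin_cases j <;> simp)
      map_smul' := fun c p => Subtype.ext (by ext i j; fin_cases i <;> fin_cases j <;> simp)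
      invFun := fun X => (((X : Matrix (Fin 3) (Fin 3) F) 0 1, (X : Matrix (Fin 3) (Fin 3) F) 1 2), (X : Matrix (Fin 3) (Fin 3) F) 0 2)
      left_inv := fun p => by simp
      right_inv := fun X => Subtype.ext (by simpa using hrepr X.1 X.2)
      continuous_toFun := by
        refine Continuous.subtype_mk (continuous_matrix fun i j => ?_) _
        fin_cases i <;> fin_cases j <;> simp <;> fun_prop
      continuous_invFun := by
        have hc : Continuous fun X : ↥𝔫 => (X : Matrix (Fin 3) (Fin 3) F) := continuous_subtype_val
        exact ((hc.matrix_elem 0 1).prodMk (hc.matrix_elem 1 2)).prodMk (hc.matrix_elem 0 2) },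
    fun X => Iff.rfl, fun p => rfl⟩

/-- **The chart of `𝔟₃`**: a subspace `𝔭 = {Y | Y.BlockTriangular id}` (upper triangular — the parabolic of the Borel labelling, ★ currency) with a continuous
linear chart `b : F⁶ ≃L 𝔭`, `b(r) = [[r₀,r₁,r₂],[0,r₃,r₄],[0,0,r₅]]`. [folklore] -/
theorem exists_upperChart :
    ∃ (𝔭 : Submodule F (Matrix (Fin 3) (Fin 3) F)) (b : (Fin 6 → F) ≃L[F] ↥𝔭),
      (∀ Y : Matrix (Fin 3) (Fin 3) F, Y ∈ 𝔭 ↔ Y.BlockTriangular id) ∧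
      ∀ r : Fin 6 → F, ((b r : ↥𝔭) : Matrix (Fin 3) (Fin 3) F) = !![r 0, r 1, r 2; 0, r 3, r 4; 0, 0, r 5] := by
  let 𝔭 : Submodule F (Matrix (Fin 3) (Fin 3) F) :=
    { carrier := {Y | ∀ i j : Fin 3, j < i → Y i j = 0}
      add_mem' := fun {X Y} hX hY i j hij => by simp [hX i j hij, hY i j hij]
      zero_mem' := fun i j hij => rfl
      smul_mem' := fun c X hX i j hij => by simp [hX i j hij] }
  have hmem : ∀ r : Fin 6 → F, (!![r 0, r 1, r 2; 0, r 3, r 4; 0, 0, r 5] : Matrix (Fin 3) (Fin 3) F) ∈ 𝔭 := fun r i j hij => by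
    fin_cases i <;> fin_cases j <;> first | rfl | exact absurd hij (by decide)
  have hrepr : ∀ Y : Matrix (Fin 3) (Fin 3) F, Y ∈ 𝔭 →
      (!![Y 0 0, Y 0 1, Y 0 2; 0, Y 1 1, Y 1 2; 0, 0, Y 2 2] : Matrix (Fin 3) (Fin 3) F) = Y := fun Y hY => by
    ext i j
    fin_cases i <;> fin_cases j <;> first | rfl | exact (hY _ _ (by decide)).symm
  refine ⟨𝔭,
    { toFun := fun r => ⟨_, hmem r⟩
      map_add' := fun r s => Subtype.ext (by ext i j; fin_cases i <;> fin_cases j <;> simp)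
      map_smul' := fun c r => Subtype.ext (by ext i j; fin_cases i <;> fin_cases j <;> simp)
      invFun := fun Y => ![(Y : Matrix (Fin 3) (Fin 3) F) 0 0, (Y : Matrix (Fin 3) (Fin 3) F) 0 1, (Y : Matrix (Fin 3) (Fin 3) F) 0 2,
        (Y : Matrix (Fin 3) (Fin 3) F) 1 1, (Y : Matrix (Fin 3) (Fin 3) F) 1 2, (Y : Matrix (Fin 3) (Fin 3) F) 2 2]
      left_inv := fun r => by funext i; fin_cases i <;> simp
      right_inv := fun Y => Subtype.ext (by simpa using hrepr Y.1 Y.2)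
      continuous_toFun := by
        refine Continuous.subtype_mk (continuous_matrix fun i j => ?_) _
        fin_cases i <;> fin_cases j <;> simp <;> fun_prop
      continuous_invFun := by
        have hc : Continuous fun Y : ↥𝔭 => (Y : Matrix (Fin 3) (Fin 3) F) := continuous_subtype_val
        refine continuous_pi fun i => ?_
        fin_cases i <;> simpa using hc.matrix_elem _ _ },
    fun Y => ?_, fun r => rfl⟩
  change (∀ i j : Fin 3, j < i → Y i j = 0) ↔ Y.BlockTriangular id
  exact ⟨fun h i j hij => h i j hij, fun h i j hij => h hij⟩

end Charts

/-! ## §3  `Λ_J ∘ 𝓕 = C · (K-average of the Borel slice)` -/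

section Main

variable [MeasurableSpace F] [BorelSpace F] [MeasurableSpace (GL (Fin 3) F)] [BorelSpace (GL (Fin 3) F)]
  [MeasurableSpace (Matrix (Fin 3) (Fin 3) F)] [BorelSpace (Matrix (Fin 3) (Fin 3) F)]

/-- **THE FOURIER TRANSFORM OF THE REGULAR RICHARDSON MEASURE OF `𝔤𝔩₃(F)`.**  For Haar measures `κ` on `K = GL₃(𝒪)`, `μ_N` on `N₃ = U_id`, an additive Haar
measure `μ𝔤` on `𝔤𝔩₃(F)` and `dx` on `F`, and a continuous non-trivial `ψ`, there is ONE `C > 0` such that for every `f ∈ C_c^∞(𝔤𝔩₃(F))`: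
`∫_{K × N₃} 𝓕f(k (u − 1) k⁻¹) d(κ ⊗ μ_N) = C · ∫_K ∫_{F⁶} f(k [[r₀,r₁,r₂],[0,r₃,r₄],[0,0,r₅]] k⁻¹) d(dx^{⊗6}) dκ` — the regular nilpotent orbital integral of `𝓕f`
is the `K`-average of the integral of `f` over the Borel subalgebra `𝔟₃ = 𝔫₃^⊥` (`𝓕f(k Y k⁻¹) = 𝓕(f ∘ Ad k)(Y)`; `u − 1 ↦` linear coordinates of `𝔫₃`, ★ (B1); `∫_{𝔫₃} 𝓕g = c₀ ∫_{𝔟₃} g`, ★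
`integral_matrixFourier_nilradical_eq_parabolic`).  [cite: HarishChandra1999AdmissibleDistributions, §7, Thm. 4.4] [cite: Howe1974, Prop. 3] -/
theorem exists_integral_prod_matrixFourier_borelRichardson_eq (ψ : AddChar F Circle) (hψ : ψ.IsContinuousNontrivial)
    (μ𝔤 : Measure (Matrix (Fin 3) (Fin 3) F)) [μ𝔤.IsAddHaarMeasure]
    (κ : Measure ↥(glInt 3 F)) [IsHaarMeasure κ] (μN : Measure ↥(unipotentRadicalGL F (id : Fin 3 → Fin 3))) [IsHaarMeasure μN]
    (dx : Measure F) [dx.IsAddHaarMeasure] :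
    ∃ C : ℝ, 0 < C ∧ ∀ f : Matrix (Fin 3) (Fin 3) F → ℂ, IsLocSmooth f →
      ∫ q : ↥(glInt 3 F) × ↥(unipotentRadicalGL F (id : Fin 3 → Fin 3)),
          (fun Y : Matrix (Fin 3) (Fin 3) F => ∫ X, ((ψ (Matrix.trace (Y * X)) : Circle) : ℂ) * f X ∂μ𝔤)
            ((((q.1 : GL (Fin 3) F)) : Matrix (Fin 3) (Fin 3) F) * ((((q.2 : GL (Fin 3) F)) : Matrix (Fin 3) (Fin 3) F) - 1) *
              ((((q.1 : GL (Fin 3) F))⁻¹ : GL (Fin 3) F) : Matrix (Fin 3) (Fin 3) F)) ∂(κ.prod μN) =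
        (C : ℂ) * ∫ k : ↥(glInt 3 F), ∫ r : Fin 6 → F,
          f (((k : GL (Fin 3) F) : Matrix (Fin 3) (Fin 3) F) * !![r 0, r 1, r 2; 0, r 3, r 4; 0, 0, r 5] *
            ((((k : GL (Fin 3) F))⁻¹ : GL (Fin 3) F) : Matrix (Fin 3) (Fin 3) F)) ∂(Measure.pi fun _ : Fin 6 => dx) ∂κ := by
  classical
  haveI : T2Space F := (isLocalField F).toT2Space
  haveI : LocallyCompactSpace F := (isLocalField F).toLocallyCompactSpace
  haveI : SecondCountableTopology F := secondCountableTopology_localField F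
  haveI : IsTopologicalRing F := inferInstance
  haveI : LocallyCompactSpace (Matrix (Fin 3) (Fin 3) F) := Pi.locallyCompactSpace_of_finite
  haveI : SecondCountableTopology (Matrix (Fin 3) (Fin 3) F) := inferInstanceAs (SecondCountableTopology (Fin 3 → Fin 3 → F))
  haveI : BorelSpace ↥(glInt 3 F) := Subtype.borelSpace _
  haveI : BorelSpace ↥(unipotentRadicalGL F (id : Fin 3 → Fin 3)) := Subtype.borelSpace _
  haveI : CompactSpace ↥(glInt 3 F) := isCompact_iff_compactSpace.1 (isCompact_glInt 3 F)
  haveI : IsFiniteMeasure κ := CompactSpace.isFiniteMeasure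
  -- charts
  obtain ⟨e, he⟩ := exists_coordHomeomorph (R := F)
  obtain ⟨𝔫, n, h𝔫, hn⟩ := exists_strictUpperChart (F := F)
  obtain ⟨𝔭, b, h𝔭, hb⟩ := exists_upperChart (F := F)
  haveI : BorelSpace ↥𝔫 := Subtype.borelSpace _
  haveI : BorelSpace ↥𝔭 := Subtype.borelSpace _
  haveI : (dx.prod dx).IsAddHaarMeasure := inferInstance
  haveI : ((dx.prod dx).prod dx).IsAddHaarMeasure := inferInstance
  haveI : SFinite ((dx.prod dx).prod dx) := inferInstance
  -- ★ subspace Fourier for the Borel labelling, with the chart measures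
  obtain ⟨c₀, hc₀, hF⟩ := integral_matrixFourier_nilradical_eq_parabolic ψ hψ μ𝔤 (id : Fin 3 → Fin 3) 𝔫 𝔭 h𝔫 h𝔭
    (((dx.prod dx).prod dx).map n) ((Measure.pi fun _ : Fin 6 => dx).map b)
  -- ★ (B1): the Haar measure of `N₃` in coordinates
  obtain ⟨C₁, hC₁, hμN⟩ := exists_haar_eq_smul_map_coord e he dx μN
  refine ⟨C₁ * c₀, mul_pos (NNReal.coe_pos.2 (pos_iff_ne_zero.2 hC₁)) hc₀, fun f hf => ?_⟩
  set Φ : Matrix (Fin 3) (Fin 3) F → ℂ := fun Y => ∫ X, ((ψ (Matrix.trace (Y * X)) : Circle) : ℂ) * f X ∂μ𝔤 with hΦ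
  have hΦsm : IsLocSmooth Φ := isLocSmooth_matrixFourier hψ μ𝔤 hf
  -- `u - 1` in coordinates
  have hsub : ∀ p : (F × F) × F, (((e p : ↥(unipotentRadicalGL F (id : Fin 3 → Fin 3))) : GL (Fin 3) F) : Matrix (Fin 3) (Fin 3) F) - 1 =
      ((n p : ↥𝔫) : Matrix (Fin 3) (Fin 3) F) := fun p => by
    rw [he, hn]
    ext i j
    fin_cases i <;> fin_cases j <;> simp
  -- Step A: `κ ⊗ μ_N = C₁ • (id × e)_* (κ ⊗ dx³)`
  have hmeas : κ.prod μN = C₁ • (κ.prod ((dx.prod dx).prod dx)).map (Prod.map (id : ↥(glInt 3 F) → ↥(glInt 3 F)) e) := by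
    have h1 : (κ.prod ((dx.prod dx).prod dx)).map (Prod.map (id : ↥(glInt 3 F) → ↥(glInt 3 F)) e) = κ.prod (((dx.prod dx).prod dx).map e) := by
      rw [← Measure.map_prod_map _ _ measurable_id e.continuous.measurable, Measure.map_id]
    rw [hμN, Measure.prod_smul_right, h1]
  have hemb : MeasurableEmbedding (Prod.map (id : ↥(glInt 3 F) → ↥(glInt 3 F)) e) :=
    ((MeasurableEquiv.refl ↥(glInt 3 F)).prodCongr e.toMeasurableEquiv).measurableEmbedding
  rw [hmeas, integral_smul_nnreal_measure, hemb.integral_map]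
  simp only [Prod.map_fst, Prod.map_snd, id_eq, hsub]
  -- Step B: Fubini on `K × F³` (the integrand is continuous with compact support)
  have hcont : Continuous fun z : ↥(glInt 3 F) × ((F × F) × F) =>
      Φ ((((z.1 : GL (Fin 3) F)) : Matrix (Fin 3) (Fin 3) F) * ((n z.2 : ↥𝔫) : Matrix (Fin 3) (Fin 3) F) *
        ((((z.1 : GL (Fin 3) F))⁻¹ : GL (Fin 3) F) : Matrix (Fin 3) (Fin 3) F)) := by
    refine hΦsm.1.continuous.comp ?_
    have h1 : Continuous fun z : ↥(glInt 3 F) × ((F × F) × F) => (((z.1 : GL (Fin 3) F)) : Matrix (Fin 3) (Fin 3) F) :=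
      Units.continuous_val.comp (continuous_subtype_val.comp continuous_fst)
    have h2 : Continuous fun z : ↥(glInt 3 F) × ((F × F) × F) => ((((z.1 : GL (Fin 3) F))⁻¹ : GL (Fin 3) F) : Matrix (Fin 3) (Fin 3) F) :=
      Units.continuous_coe_inv.comp (continuous_subtype_val.comp continuous_fst)
    have h3 : Continuous fun z : ↥(glInt 3 F) × ((F × F) × F) => ((n z.2 : ↥𝔫) : Matrix (Fin 3) (Fin 3) F) :=
      continuous_subtype_val.comp (n.continuous.comp continuous_snd)
    exact (h1.mul h3).mul h2
  have hcs : HasCompactSupport fun z : ↥(glInt 3 F) × ((F × F) × F) =>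
      Φ ((((z.1 : GL (Fin 3) F)) : Matrix (Fin 3) (Fin 3) F) * ((n z.2 : ↥𝔫) : Matrix (Fin 3) (Fin 3) F) *
        ((((z.1 : GL (Fin 3) F))⁻¹ : GL (Fin 3) F) : Matrix (Fin 3) (Fin 3) F)) := by
    -- `k n(p) k⁻¹ ∈ tsupport Φ ⇒ n(p) ∈ K⁻¹ (tsupport Φ) K ⇒ p ∈ π(K⁻¹ (tsupport Φ) K)`
    set C' : Set (Matrix (Fin 3) (Fin 3) F) := (fun q : ↥(glInt 3 F) × Matrix (Fin 3) (Fin 3) F =>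
        ((((q.1 : GL (Fin 3) F))⁻¹ : GL (Fin 3) F) : Matrix (Fin 3) (Fin 3) F) * q.2 * (((q.1 : GL (Fin 3) F)) : Matrix (Fin 3) (Fin 3) F)) ''
      (Set.univ ×ˢ tsupport Φ) with hC'
    have hC'c : IsCompact C' := by
      refine (isCompact_univ.prod hΦsm.2).image ?_
      exact ((Units.continuous_coe_inv.comp (continuous_subtype_val.comp continuous_fst)).mul continuous_snd).mul
        (Units.continuous_val.comp (continuous_subtype_val.comp continuous_fst))
    set π : Matrix (Fin 3) (Fin 3) F → (F × F) × F := fun X => ((X 0 1, X 1 2), X 0 2) with hπ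
    have hπc : Continuous π := ((continuous_id.matrix_elem 0 1).prodMk (continuous_id.matrix_elem 1 2)).prodMk (continuous_id.matrix_elem 0 2)
    have hπn : ∀ p : (F × F) × F, π ((n p : ↥𝔫) : Matrix (Fin 3) (Fin 3) F) = p := fun p => by
      rw [hn]; simp [hπ]
    refine IsCompact.of_isClosed_subset (isCompact_univ.prod (hC'c.image hπc)) (isClosed_tsupport _)
      (closure_minimal (fun z hz => ?_) ((isCompact_univ.prod (hC'c.image hπc)).isClosed))
    refine Set.mk_mem_prod (Set.mem_univ _) ⟨((n z.2 : ↥𝔫) : Matrix (Fin 3) (Fin 3) F), ⟨⟨z.1, _⟩, Set.mk_mem_prod (Set.mem_univ _)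
      (subset_tsupport _ hz), ?_⟩, hπn z.2⟩
    have hkk : ((((z.1 : GL (Fin 3) F))⁻¹ : GL (Fin 3) F) : Matrix (Fin 3) (Fin 3) F) * (((z.1 : GL (Fin 3) F)) : Matrix (Fin 3) (Fin 3) F) = 1 := by
      rw [← Units.val_mul, inv_mul_cancel, Units.val_one]
    simp only [← Matrix.mul_assoc, hkk, Matrix.one_mul]
    rw [Matrix.mul_assoc, hkk, Matrix.mul_one]
  rw [integral_prod _ (hcont.integrable_of_hasCompactSupport hcs)]
  -- Step C: the inner integral for each `k`
  have hinner : ∀ k : ↥(glInt 3 F),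
      ∫ p : (F × F) × F, Φ ((((k : GL (Fin 3) F)) : Matrix (Fin 3) (Fin 3) F) * ((n p : ↥𝔫) : Matrix (Fin 3) (Fin 3) F) *
          ((((k : GL (Fin 3) F))⁻¹ : GL (Fin 3) F) : Matrix (Fin 3) (Fin 3) F)) ∂((dx.prod dx).prod dx) =
        (c₀ : ℂ) * ∫ r : Fin 6 → F, f (((k : GL (Fin 3) F) : Matrix (Fin 3) (Fin 3) F) * !![r 0, r 1, r 2; 0, r 3, r 4; 0, 0, r 5] *
          ((((k : GL (Fin 3) F))⁻¹ : GL (Fin 3) F) : Matrix (Fin 3) (Fin 3) F)) ∂(Measure.pi fun _ : Fin 6 => dx) := fun k => by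
    -- `Φ(k Y k⁻¹) = 𝓕(f ∘ Ad k)(Y)`, `f ∘ Ad k ∈ C_c^∞`
    have hconj : ∀ Y : Matrix (Fin 3) (Fin 3) F, Φ ((((k : GL (Fin 3) F)) : Matrix (Fin 3) (Fin 3) F) * Y *
        ((((k : GL (Fin 3) F))⁻¹ : GL (Fin 3) F) : Matrix (Fin 3) (Fin 3) F)) =
        ∫ X, ((ψ (Matrix.trace (Y * X)) : Circle) : ℂ) *
          f ((((k : GL (Fin 3) F)) : Matrix (Fin 3) (Fin 3) F) * X * ((((k : GL (Fin 3) F))⁻¹ : GL (Fin 3) F) : Matrix (Fin 3) (Fin 3) F)) ∂μ𝔤 :=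
      fun Y => matrixFourier_conj_apply ψ μ𝔤 k.2 f Y
    have hkk : ((((k : GL (Fin 3) F))⁻¹ : GL (Fin 3) F) : Matrix (Fin 3) (Fin 3) F) * (((k : GL (Fin 3) F)) : Matrix (Fin 3) (Fin 3) F) = 1 := by
      rw [← Units.val_mul, inv_mul_cancel, Units.val_one]
    have hkk' : (((k : GL (Fin 3) F)) : Matrix (Fin 3) (Fin 3) F) * ((((k : GL (Fin 3) F))⁻¹ : GL (Fin 3) F) : Matrix (Fin 3) (Fin 3) F) = 1 := by
      rw [← Units.val_mul, mul_inv_cancel, Units.val_one]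
    let Adk : Matrix (Fin 3) (Fin 3) F ≃ₜ Matrix (Fin 3) (Fin 3) F :=
      { toFun := fun X => (((k : GL (Fin 3) F)) : Matrix (Fin 3) (Fin 3) F) * X * ((((k : GL (Fin 3) F))⁻¹ : GL (Fin 3) F) : Matrix (Fin 3) (Fin 3) F)
        invFun := fun X => ((((k : GL (Fin 3) F))⁻¹ : GL (Fin 3) F) : Matrix (Fin 3) (Fin 3) F) * X * (((k : GL (Fin 3) F)) : Matrix (Fin 3) (Fin 3) F)
        left_inv := fun X => by
          simp only [← Matrix.mul_assoc, hkk, Matrix.one_mul]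
          rw [Matrix.mul_assoc, hkk, Matrix.mul_one]
        right_inv := fun X => by
          simp only [← Matrix.mul_assoc, hkk', Matrix.one_mul]
          rw [Matrix.mul_assoc, hkk', Matrix.mul_one]
        continuous_toFun := (continuous_const.matrix_mul continuous_id).matrix_mul continuous_const
        continuous_invFun := (continuous_const.matrix_mul continuous_id).matrix_mul continuous_const }
    have hg : IsLocSmooth fun X : Matrix (Fin 3) (Fin 3) F =>
        f ((((k : GL (Fin 3) F)) : Matrix (Fin 3) (Fin 3) F) * X * ((((k : GL (Fin 3) F))⁻¹ : GL (Fin 3) F) : Matrix (Fin 3) (Fin 3) F)) :=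
      ⟨hf.1.comp_continuous Adk.continuous, hf.2.comp_homeomorph Adk⟩
    simp_rw [hconj]
    -- `∫_{F³} 𝓕g(n p) dp = ∫_{𝔫} 𝓕g dμ𝔫 = c₀ ∫_{𝔭} g dμ𝔭 = c₀ ∫_{F⁶} g(b r) dr`
    have h1 := hF _ hg.1 hg.2
    have hn_emb : MeasurableEmbedding ⇑n := n.toHomeomorph.measurableEmbedding
    have hb_emb : MeasurableEmbedding ⇑b := b.toHomeomorph.measurableEmbedding
    rw [hn_emb.integral_map, hb_emb.integral_map] at h1
    simpa only [hb] using h1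
  simp_rw [hinner]
  rw [integral_const_mul, NNReal.smul_def, Complex.real_smul]
  push_cast
  ring

end Main

end Summit.HodgeConjecture.HodgeConjecture.Cruxes.H413.K2E3GL3RegularRichardsonFourier

end
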